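import Literature.IUT.HodgeTheaters.InitialThetaDataLocalArrowTransport
import HarnessLib

/-!
# [IUTchI] Definition 3.1 (e)/(f): Definition 1.1 run on the LOCAL §1 datum agrees with the base change of
# `Π_{X̲→_K}` — `Π_{X̲→}(C_v̲) = Π_v̲ := Π_{X̲→_K} ×_{G_K} G_v̲`

S. Mochizuki, *Inter-universal Teichmüller theory I*, §3, Def. 3.1 (e), (f) (kurims manuscript, May 2020, pp. 62–63)
[claim: Mochizuki2012, status: disputed]: (e) "for each `v̲ ∈ V(K)`, we shall use the subscript `v̲` to denote the result
of base-changing hyperbolic orbicurves over `F` or `K` to `K_v̲`"; (f) "the data `(X_K, C̲_K, ε̲)` determines, up to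
`K`-isomorphism [cf. Remark 1.2.1], a finite étale covering `C̲→_K → C̲_K` … open subgroups `Π_{X̲→_K} ⊆ Π_{C̲→_K} ⊆
Π_{C_F}` … and, for `v ∈ V̲^good`, `Π_{X̲→_v} ⊆ Π_{C̲→_v} ⊆ Π_{C_v}`. If `v ∈ V̲^good`, then we shall write `Π_v :=
Π_{X̲→_v}`"; §1 Remark 1.1.2 p. 39: "We observe that `X→`, `C→` are completely determined, up to `k`-isomorphism, by
the data `(X/k, C̲, ε̲)`" [our gloss, not print: hence so are, up to isomorphism, their arithmetic fundamental groups
`Π_{X→}`, `Π_{C→}`]. (v2: this citation corrected — page and verbatim wording — per referee flag M18-F3; no declaration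
changed.)

PROOF-ONLY sequel, part 2 of 2 (theorems only; no definitions, no instances), of `InitialThetaDataLocalPuncturedData`
(abc-iut-L5-t2, p421799), which CONSTRUCTED the §1 datum `D.peLoc k ι` of the local core `C_v̲ := C_K ×_K K_v̲` and left
to a sequel the comparison of abc-iut-L5-t1's Def. 1.1 CONSTRUCTION `PuncturedEllipticData.piXarrow` run on it with
the base change `D.PiLoc D.PiXarrow (localToGF F k ι)` of print's `Π_{X̲→_K}` (`InitialThetaDataLocalGroups`; the group
`Π_v̲` of `D_v̲ = 𝓑(Π_v̲)⁰` in Ex. 3.3 at the datum, `InitialThetaDataGoodLocalFrobenioid`). With `T`, `e` as in part 1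
(`InitialThetaDataLocalArrowTransport`):
* **`T(jKer_v̲) = e(jKer)`**, `T(galKer_v̲) = e(galKer)` — the geometric parts `Δ_{X̲→} = jKer`, `Δ_{C̲→}` are unchanged;
* **`T(Π_{X̲→}(C_v̲)) = (D_{2ε} ×_{G_F} Gal(Ω/k)) · e(jKer)`** (`map_subtype_peLoc_piXarrow`) — CONTAINED in
  `Π_v̲ := Π_{X̲→_K} ×_{G_F} Gal(Ω/k)` unconditionally (`map_subtype_peLoc_piXarrow_le`) and EQUAL to it
  (`map_subtype_peLoc_piXarrow_eq`, `peLoc_piXarrow_eq_subgroupOf`) as soon as `D_{2ε}` normalises `jKer`, which the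
  printed §1 claims give BY NAME (`ArrowCoveringClaims.jKer_normal`: `jKer ⊴ Π_{C̲_K}`); likewise `Π_{C̲→}`
  (`map_subtype_peLoc_piCarrow_le/_eq`, `peLoc_piCarrow_eq_subgroupOf`). Without that normality the local construction
  can only be smaller: the join `D_{2ε} ⊔ jKer` base-changes to the join of the base changes when it is the pointwise
  product `D_{2ε}·jKer` (then `augGF (d·j) = augGF d` splits every element over `G_v̲`);
* `map_subtype_peLoc_piXarrow_inf_deltaC` — the geometric part of `Π_{X̲→}(C_v̲)` is `e(jKer)`, from the §1 section
  clause `Π_{X̲→} ∩ Δ_{C_K} = jKer` BY NAME.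
So the cusps / decomposition groups of `D.peLoc k ι` (consumed by the §4–§6 label bindings, abc-iut-L5-t4) and the
group `Π_v̲` of the Frobenioid base `D_v̲` (Ex. 3.3 at the datum, abc-iut-L5-t2) live in ONE subgroup lattice and agree.
Nothing of the series is asserted; the §1 claims enter only as the hypothesis `hA : D.geom.pe.ArrowCoveringClaims`.
-/

noncomputable section

namespace Literature.IUT.HodgeTheaters

open Topology

universe u v w

namespace InitialThetaData

section PeLoc

variable {F : Type u} {K : Type v} {Fbar : Type w} [Field F] [NumberField F] [Field K] [NumberField K]
  [Algebra F K] [Field Fbar] [Algebra F Fbar] [Algebra K Fbar] [IsScalarTower F K Fbar] [Normal K Fbar]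
  [Algebra.IsIntegral F Fbar]
  {E : WeierstrassCurve F} [E.IsElliptic] {l : ℕ} {Pb : BadPlacePredicates K}
  (D : InitialThetaData F K Fbar E l Pb)
  {Ω : Type w} [Field Ω] [Algebra K Ω]
  (k : Type w) [Field k] [Algebra K k] [Algebra k Ω] [IsScalarTower K k Ω] [IsGalois k Ω] (ι : Fbar →ₐ[K] Ω)

/-! ### The geometric parts `jKer`, `galKer` are unchanged by base change -/

/-- **`T(jKer_v̲) = e(jKer)`** — `Ker(Δ_{X̲} ↠ Δ_ε⁺)`, the geometric part `Δ_{X̲→}` of print's `Π_{X̲→}`, is unchanged by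
the base change `K ↪ K_v̲`. [claim: Mochizuki2012, status: disputed] -/
theorem map_subtype_peLoc_jKer :
    Subgroup.map (G := (D.peLoc k ι).PiC) (D.PiLoc D.PiCK (localToGF F k ι)).subtype (D.peLoc k ι).jKer =
      D.geom.pe.jKer.map (D.embLoc k) := by
  rw [(D.peLoc k ι).map_jKer_eq, D.geom.pe.map_jKer_eq, map_subtype_peLoc_deltaEpsKer,
    Set.Subset.antisymm
      (image_commSet_subset (A := (D.peLoc k ι).PiC) (B := D.geom.pe.PiC)
        (D.PiLoc D.PiCK (localToGF F k ι)).subtype (D.embLoc k)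
        (D.PiLoc D.PiCK (localToGF F k ι)).subtype_injective _ _ _ _
        (D.map_subtype_peLoc_deltaXbar k ι) (D.map_subtype_peLoc_deltaCbar k ι))
      (image_commSet_subset (A := D.geom.pe.PiC) (B := (D.peLoc k ι).PiC)
        (D.embLoc k) (D.PiLoc D.PiCK (localToGF F k ι)).subtype (D.embLoc_injective k) _ _ _ _
        (D.map_subtype_peLoc_deltaXbar k ι).symm (D.map_subtype_peLoc_deltaCbar k ι).symm)]

/-- `T(galKer_v̲) = e(galKer)` (the inverse image of `Gal(X̲/C̲)` in `Δ_{C̲}` is geometric).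
[claim: Mochizuki2012, status: disputed] -/
theorem map_subtype_peLoc_galKer :
    Subgroup.map (G := (D.peLoc k ι).PiC) (D.PiLoc D.PiCK (localToGF F k ι)).subtype (D.peLoc k ι).galKer =
      D.geom.pe.galKer.map (D.embLoc k) := by
  rw [(D.peLoc k ι).map_galKer_eq, D.geom.pe.map_galKer_eq, map_subtype_peLoc_jKer, map_subtype_peLoc_deltaCbar]
  rfl

/-! ### `Π_{X̲→}` and `Π_{C̲→}` of the local datum vs. the base changes `Π_v̲ = Π_{X̲→_v̲}`, `Π_{C̲→_v̲}` -/

/-- **`T(Π_{X̲→}(C_v̲)) = (D_{2ε} ×_{G_F} Gal(Ω/k)) · e(jKer)`**: Def. 1.1's `Π_{X→} = D_{2ε}·jKer` run on the local datum,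
inside `Π_{C_F} × Gal(Ω/k)`. [claim: Mochizuki2012, status: disputed] -/
theorem map_subtype_peLoc_piXarrow :
    Subgroup.map (G := (D.peLoc k ι).PiC) (D.PiLoc D.PiCK (localToGF F k ι)).subtype (D.peLoc k ι).piXarrow =
      D.PiLoc ((D.geom.pe.decomp D.geom.pe.twoε).map D.geom.embK) (localToGF F k ι) ⊔
        D.geom.pe.jKer.map (D.embLoc k) := by
  rw [(D.peLoc k ι).map_piXarrow_eq, map_subtype_peLoc_jKer, map_subtype_peLoc_decomp]
  rfl

/-- `T(Π_{C̲→}(C_v̲)) = (D_{2ε} ×_{G_F} Gal(Ω/k)) · e(galKer)`. [claim: Mochizuki2012, status: disputed] -/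
theorem map_subtype_peLoc_piCarrow :
    Subgroup.map (G := (D.peLoc k ι).PiC) (D.PiLoc D.PiCK (localToGF F k ι)).subtype (D.peLoc k ι).piCarrow =
      D.PiLoc ((D.geom.pe.decomp D.geom.pe.twoε).map D.geom.embK) (localToGF F k ι) ⊔
        D.geom.pe.galKer.map (D.embLoc k) := by
  rw [(D.peLoc k ι).map_piCarrow_eq, map_subtype_peLoc_galKer, map_subtype_peLoc_decomp]
  rfl

/-- **`Π_{X̲→}(C_v̲) ⊆ Π_v̲ := Π_{X̲→_K} ×_{G_F} Gal(Ω/k)`**, unconditionally. [claim: Mochizuki2012, status: disputed] -/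
theorem map_subtype_peLoc_piXarrow_le :
    Subgroup.map (G := (D.peLoc k ι).PiC) (D.PiLoc D.PiCK (localToGF F k ι)).subtype (D.peLoc k ι).piXarrow ≤
      D.PiLoc D.PiXarrow (localToGF F k ι) := by
  rw [map_subtype_peLoc_piXarrow]
  refine sup_le (D.PiLoc_mono _ (Subgroup.map_mono D.geom.pe.decomp_twoε_le_piXarrow)) ?_
  exact (D.map_embLoc_le_PiLoc k (localToGF F k ι) (D.geom.pe.jKer_le_deltaXbar.trans inf_le_right)).trans
    (D.PiLoc_mono _ (Subgroup.map_mono le_sup_right))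

/-- **`Π_{C̲→}(C_v̲) ⊆ Π_{C̲→_v̲} := Π_{C̲→_K} ×_{G_F} Gal(Ω/k)`**, unconditionally. [claim: Mochizuki2012, status: disputed] -/
theorem map_subtype_peLoc_piCarrow_le :
    Subgroup.map (G := (D.peLoc k ι).PiC) (D.PiLoc D.PiCK (localToGF F k ι)).subtype (D.peLoc k ι).piCarrow ≤
      D.PiLoc D.PiCarrow (localToGF F k ι) := by
  rw [map_subtype_peLoc_piCarrow]
  refine sup_le (D.PiLoc_mono _ (Subgroup.map_mono D.geom.pe.decomp_twoε_le_piCarrow)) ?_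
  exact (D.map_embLoc_le_PiLoc k (localToGF F k ι) (D.geom.pe.galKer_le_deltaCbar.trans inf_le_right)).trans
    (D.PiLoc_mono _ (Subgroup.map_mono le_sup_right))

omit [IsScalarTower F K Fbar] [Normal K Fbar] [Algebra.IsIntegral F Fbar] [Algebra K Ω] [Algebra K k]
  [IsScalarTower K k Ω] [IsGalois k Ω] in
/-- Under the printed §1 claims (`jKer ⊴ Π_{C̲}`), `D_{2ε}` normalises `jKer`, so `Π_{X→} = D_{2ε} ⊔ jKer` is the
pointwise product `D_{2ε} · jKer`. [claim: Mochizuki2012, status: disputed] -/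
theorem decomp_twoε_le_normalizer_jKer (hA : D.geom.pe.ArrowCoveringClaims) :
    D.geom.pe.decomp D.geom.pe.twoε ≤ Subgroup.normalizer (D.geom.pe.jKer : Set D.geom.pe.PiC) :=
  ((D.geom.pe.decomp_le _).trans inf_le_right).trans
    ((Subgroup.normal_subgroupOf_iff_le_normalizer (le_sup_right.trans D.geom.pe.piXarrow_le_piCbar)).mp
      hA.jKer_normal)

omit [IsScalarTower F K Fbar] [Normal K Fbar] [Algebra.IsIntegral F Fbar] [Algebra K Ω] [Algebra K k]
  [IsScalarTower K k Ω] [IsGalois k Ω] in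
/-- Under the printed §1 claims, `D_{2ε}` normalises `galKer = jKer · (Δ_{C̲})^l` as well (`Π_{C̲}` normalises `Δ_{C̲}`,
hence the set of its `l`-th powers). [claim: Mochizuki2012, status: disputed] -/
theorem decomp_twoε_le_normalizer_galKer (hA : D.geom.pe.ArrowCoveringClaims) :
    D.geom.pe.decomp D.geom.pe.twoε ≤ Subgroup.normalizer (D.geom.pe.galKer : Set D.geom.pe.PiC) := by
  intro d hd
  have hdC : d ∈ D.geom.pe.PiCbar := (D.geom.pe.decomp_le _ hd).2
  refine Subgroup.normalizer_inf_normalizer_le_normalizer_sup _ _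
    (Subgroup.mem_inf.mpr ⟨D.decomp_twoε_le_normalizer_jKer hA hd, ?_⟩)
  refine Subgroup.normalizer_le_normalizer_closure _ ?_
  have hconj : ∀ g y : D.geom.pe.PiC, g ∈ D.geom.pe.PiCbar → y ∈ D.geom.pe.DeltaCbar →
      g * y * g⁻¹ ∈ D.geom.pe.DeltaCbar := fun g y hg hy =>
    Subgroup.mem_inf.mpr ⟨D.geom.pe.PiCbar.mul_mem (D.geom.pe.PiCbar.mul_mem hg hy.1) (D.geom.pe.PiCbar.inv_mem hg),
      D.geom.pe.E.normal_geom.conj_mem y hy.2 g⟩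
  refine Subgroup.mem_set_normalizer_iff.mpr fun n => ⟨?_, ?_⟩
  · rintro ⟨y, hy, rfl⟩
    exact ⟨d * y * d⁻¹, hconj d y hdC hy, by simp only [conj_pow]⟩
  · rintro ⟨y, hy, hye⟩
    refine ⟨d⁻¹ * y * d⁻¹⁻¹, hconj d⁻¹ y (D.geom.pe.PiCbar.inv_mem hdC) hy, ?_⟩
    have hye' : y ^ D.geom.pe.l = d * n * d⁻¹ := hye
    show (d⁻¹ * y * d⁻¹⁻¹) ^ D.geom.pe.l = n
    rw [conj_pow, hye']
    group

/-- **`Π_{X̲→}(C_v̲) = Π_v̲ := Π_{X̲→_K} ×_{G_F} Gal(Ω/k)` given the printed §1 claims** (what is used: `jKer ⊴ Π_{C̲_K}`):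
Definition 1.1 run on the local §1 datum `D.peLoc k ι` recovers exactly the base change of print's `Π_{X̲→_K}`
(Def. 3.1 (e)/(f) "`Π_v := Π_{X̲→_v}`"; Rmk 1.1.2). [claim: Mochizuki2012, status: disputed] -/
theorem map_subtype_peLoc_piXarrow_eq (hA : D.geom.pe.ArrowCoveringClaims) :
    Subgroup.map (G := (D.peLoc k ι).PiC) (D.PiLoc D.PiCK (localToGF F k ι)).subtype (D.peLoc k ι).piXarrow =
      D.PiLoc D.PiXarrow (localToGF F k ι) := by
  refine le_antisymm (D.map_subtype_peLoc_piXarrow_le k ι) ?_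
  rw [map_subtype_peLoc_piXarrow]
  intro z hz
  obtain ⟨hz1, hz2⟩ := (D.mem_PiLoc _ _ z).mp hz
  obtain ⟨y, hy, hyz⟩ := hz1
  have hy' : y ∈ ((D.geom.pe.decomp D.geom.pe.twoε ⊔ D.geom.pe.jKer : Subgroup D.geom.pe.PiC) :
      Set D.geom.pe.PiC) := hy
  rw [Subgroup.coe_mul_of_left_le_normalizer_right _ _ (D.decomp_twoε_le_normalizer_jKer hA)] at hy'
  obtain ⟨d, hd, j, hj, rfl⟩ := Set.mem_mul.mp hy'
  have hjΔ : j ∈ D.geom.pe.E.geom := (D.geom.pe.jKer_le_deltaXbar hj).2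
  have hj1 : D.augGF (D.geom.embK j) = 1 := (D.augGF_eq_one_iff _).mpr ((D.embK_mem_deltaC_iff j).mpr hjΔ)
  have haug : D.augGF (D.geom.embK d) = localToGF F k ι z.2 := by
    rw [← hz2, ← hyz, map_mul, map_mul, hj1, mul_one]
  have hz_eq : z = (D.geom.embK d, z.2) * D.embLoc k j := by
    rw [embLoc_apply, Prod.mk_mul_mk, mul_one, ← map_mul, hyz]
  rw [hz_eq]
  exact Subgroup.mul_mem _
    (Subgroup.mem_sup_left ((D.mem_PiLoc _ _ _).mpr ⟨⟨d, hd, rfl⟩, haug⟩))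
    (Subgroup.mem_sup_right ⟨j, hj, rfl⟩)

/-- **`Π_{C̲→}(C_v̲) = Π_{C̲→_v̲} := Π_{C̲→_K} ×_{G_F} Gal(Ω/k)` given the printed §1 claims.** [claim: Mochizuki2012, status: disputed] -/
theorem map_subtype_peLoc_piCarrow_eq (hA : D.geom.pe.ArrowCoveringClaims) :
    Subgroup.map (G := (D.peLoc k ι).PiC) (D.PiLoc D.PiCK (localToGF F k ι)).subtype (D.peLoc k ι).piCarrow =
      D.PiLoc D.PiCarrow (localToGF F k ι) := by
  refine le_antisymm (D.map_subtype_peLoc_piCarrow_le k ι) ?_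
  rw [map_subtype_peLoc_piCarrow]
  intro z hz
  obtain ⟨hz1, hz2⟩ := (D.mem_PiLoc _ _ z).mp hz
  obtain ⟨y, hy, hyz⟩ := hz1
  have hy' : y ∈ ((D.geom.pe.decomp D.geom.pe.twoε ⊔ D.geom.pe.galKer : Subgroup D.geom.pe.PiC) :
      Set D.geom.pe.PiC) := hy
  rw [Subgroup.coe_mul_of_left_le_normalizer_right _ _ (D.decomp_twoε_le_normalizer_galKer hA)] at hy'
  obtain ⟨d, hd, j, hj, rfl⟩ := Set.mem_mul.mp hy'
  have hjΔ : j ∈ D.geom.pe.E.geom := (D.geom.pe.galKer_le_deltaCbar hj).2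
  have hj1 : D.augGF (D.geom.embK j) = 1 := (D.augGF_eq_one_iff _).mpr ((D.embK_mem_deltaC_iff j).mpr hjΔ)
  have haug : D.augGF (D.geom.embK d) = localToGF F k ι z.2 := by
    rw [← hz2, ← hyz, map_mul, map_mul, hj1, mul_one]
  have hz_eq : z = (D.geom.embK d, z.2) * D.embLoc k j := by
    rw [embLoc_apply, Prod.mk_mul_mk, mul_one, ← map_mul, hyz]
  rw [hz_eq]
  exact Subgroup.mul_mem _
    (Subgroup.mem_sup_left ((D.mem_PiLoc _ _ _).mpr ⟨⟨d, hd, rfl⟩, haug⟩))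
    (Subgroup.mem_sup_right ⟨j, hj, rfl⟩)

/-- **`Π_{X̲→}(C_v̲)` IS `Π_v̲` as a subgroup of `Π_{C_v̲}`** (given the §1 claims): the local datum's `piXarrow` is
`Π_v̲` pulled back along `Π_{C_v̲} ⊆ Π_{C_F} × Gal(Ω/k)`. [claim: Mochizuki2012, status: disputed] -/
theorem peLoc_piXarrow_eq_subgroupOf (hA : D.geom.pe.ArrowCoveringClaims) :
    (D.peLoc k ι).piXarrow =
      (D.PiLoc D.PiXarrow (localToGF F k ι)).subgroupOf (D.PiLoc D.PiCK (localToGF F k ι)) := by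
  have h := D.map_subtype_peLoc_piXarrow_eq k ι hA
  ext x
  constructor
  · intro hx
    exact h.le ⟨x, hx, rfl⟩
  · intro hx
    obtain ⟨y, hy, hyx⟩ := h.ge hx
    obtain rfl : y = x := Subtype.ext hyx
    exact hy

/-- **`Π_{C̲→}(C_v̲)` IS `Π_{C̲→_v̲}` as a subgroup of `Π_{C_v̲}`** (given the §1 claims). [claim: Mochizuki2012, status: disputed] -/
theorem peLoc_piCarrow_eq_subgroupOf (hA : D.geom.pe.ArrowCoveringClaims) :
    (D.peLoc k ι).piCarrow =
      (D.PiLoc D.PiCarrow (localToGF F k ι)).subgroupOf (D.PiLoc D.PiCK (localToGF F k ι)) := by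
  have h := D.map_subtype_peLoc_piCarrow_eq k ι hA
  ext x
  constructor
  · intro hx
    exact h.le ⟨x, hx, rfl⟩
  · intro hx
    obtain ⟨y, hy, hyx⟩ := h.ge hx
    obtain rfl : y = x := Subtype.ext hyx
    exact hy

/-- Unconditionally `Π_{X̲→}(C_v̲) ⊆ Π_v̲` (pulled back to `Π_{C_v̲}`). [claim: Mochizuki2012, status: disputed] -/
theorem peLoc_piXarrow_le_subgroupOf :
    (D.peLoc k ι).piXarrow ≤
      (D.PiLoc D.PiXarrow (localToGF F k ι)).subgroupOf (D.PiLoc D.PiCK (localToGF F k ι)) :=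
  fun x hx => D.map_subtype_peLoc_piXarrow_le k ι ⟨x, hx, rfl⟩

/-- Unconditionally `Π_{C̲→}(C_v̲) ⊆ Π_{C̲→_v̲}` (pulled back to `Π_{C_v̲}`). [claim: Mochizuki2012, status: disputed] -/
theorem peLoc_piCarrow_le_subgroupOf :
    (D.peLoc k ι).piCarrow ≤
      (D.PiLoc D.PiCarrow (localToGF F k ι)).subgroupOf (D.PiLoc D.PiCK (localToGF F k ι)) :=
  fun x hx => D.map_subtype_peLoc_piCarrow_le k ι ⟨x, hx, rfl⟩

/-- **The geometric part of `Π_{X̲→}(C_v̲)` is `e(jKer)`** — the local Def. 1.1 group meets `Δ_{C,v̲}` in exactly the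
image of `Δ_{X̲→} = jKer`, given the §1 section clause `Π_{X̲→} ∩ Δ_{C_K} = jKer` BY NAME (and `jKer ⊴ Π_{C̲_K}`).
[claim: Mochizuki2012, status: disputed] -/
theorem map_subtype_peLoc_piXarrow_inf_deltaC (hA : D.geom.pe.ArrowCoveringClaims) :
    Subgroup.map (G := (D.peLoc k ι).PiC) (D.PiLoc D.PiCK (localToGF F k ι)).subtype
        ((D.peLoc k ι).piXarrow ⊓ (D.peLoc k ι).DeltaC) = D.geom.pe.jKer.map (D.embLoc k) := by
  rw [Subgroup.map_inf_eq (D.peLoc k ι).piXarrow (D.peLoc k ι).DeltaC, D.map_subtype_peLoc_piXarrow_eq k ι hA,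
    map_subtype_peLoc_deltaC, show D.PiXarrow = D.geom.pe.piXarrow.map D.geom.embK from rfl,
    PiLoc_map_inf_map_embLoc_deltaC, hA.piXarrow_inf_delta]
  exact (D.PiLoc D.PiCK (localToGF F k ι)).subtype_injective

end PeLoc

end InitialThetaData

end Literature.IUT.HodgeTheaters

end
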